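import Mathlib
import HarnessLib
import Summits.HubbardSuperconductivity.HubbardSuperconductivity.Theorems.KLProgrammeH10TwoPointLimitFrameSectorCell

/-!
# Route `KLProgramme` — K3 engine child `KLRegimeEngineV17F2` (stmt-HubbardSuperconductivity-20437), stub (b) `(Hμ)` re-sectorisation:
# THE LAST LEG IS DETERMINED on the curve of a frame — thin shell, SHARP sector, arbitrary target (frame layer)

Cell gate-hubbard-kl, seat p4 (C5a sector-counting lead), g11; E1-TOWER-BLOCKED §8 («torus relative count») / §10 (d) («p4's rows … on-class
`R₂(F,Δ) ≤ c^L 2^{Δ(L−F−1)}`»), and the `R`-slot of k3c2-p3's `EngineV8.hubbardSectorKernelNorm_klAniso_jump_le_of_relCount` («row (V)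
`relCount_lastLeg_frame_le` today»).  The lineage's one-determined-leg count (Benfatto–Giuliani–Mastropietro 2006 (2.83)/(2.89): once all the other
legs' momenta are known to thin-sector precision, momentum conservation — modulo the reciprocal lattice — leaves `O(1)` thin sectors for the last leg,
because `|k⃗| ≥ u_min > 0` on the shell) in the form the engine dictionary consumes:

* **`lastLegCount_thin_frame`** — on the curve of every frame `K : TrigPolyC4v` of small `C²` size (`4A ≤ κ`): the number of SHARP sectors
  `ι < sectorCount n` containing the polar angle of a momentum of the thin frame shell `|frameLevel μ K| ≤ c_T·w_n²` within `c_ρ·w_n` of an ARBITRARY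
  target `q ∈ ℝ²` (coordinatewise) is `≤ D(window, c_T, c_ρ)` — uniformly in the frame, `μ`, `n`, `q` (`frame_cell` + `card_grid_in_box_le_radial`;
  scales with `w_n` above a window-dependent threshold are absorbed by the trivial bound `sectorCount n = 2π/w_n`).

The engine-vocabulary consequences (`card_lastLeg_bgmSectorSet_klAniso_le_frame[OK]`, the relative jump count with prescribed legs) are the companion
files `…KlAnisoLastLegCount` / `…KLRegimeEngineNormsJumpLastLegCount`.  Everything is PROVED; no definitions, no named facts.  References: BGM 2006
§2.5 (2.45), §2.8 (2.83), (2.89), App. A3 [cite: BenfattoGiulianiMastropietro2006]; HOME/prover-p4/COUNTING-NOTE-2.md §5 (one determined leg is uniform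
modulo `2πℤ²`; Lemma A3.1's two are not).
-/

noncomputable section

namespace Summit.HubbardSuperconductivity.HubbardSuperconductivity.Theorems.PerturbedFermiCurve

set_option linter.dupNamespace false -- summit = problem name (single-conjunct summit), D-0017

open Classical
open Real Set Finset
open Literature.MathematicalPhysics.QuantumLattice Literature.MathematicalPhysics.QuantumLattice.BandSectorCounting
open Literature.Probability.LatticeModels
open Summit.HubbardSuperconductivity.HubbardSuperconductivity.Theorems.DispersionFlow
open Summit.HubbardSuperconductivity.HubbardSuperconductivity.Theorems.KLRegimeSplit
open Summit.HubbardSuperconductivity.HubbardSuperconductivity.Theorems.KLProgrammeLegKernels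

/-! ## §1 The last leg on the curve of a frame: thin shell, sharp sector, target ball of radius `c_ρ·w_n` -/

/-- A sharp sector index pins the polar angle to within half a sector width of the sector centre (mod `2π`). [folklore] -/
theorem exists_abs_arg_sub_sectorCenter_le (n : ℕ) (θ : ℝ) :
    ∃ m : ℤ, |θ + m * (2 * π) - sectorCenter n (sectorIndex n θ)| ≤ sectorWidth n / 2 := by
  obtain ⟨m, hm⟩ := exists_angleRep_eq_add θ
  exact ⟨m, by rw [← hm]; exact abs_angleRep_sub_sectorCenter_le n θ⟩

/-- **THE LAST LEG IS DETERMINED, ON THE CURVE OF A FRAME, THIN SHELL, SHARP SECTOR** (BGM 2006 (2.89) / the lineage's row (V), constants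
absorbed): for every level window `[μ₁, μ₂] ⊂ (-4, 0)`, thickness constant `c_T ≥ 0` and target-radius constant `c_ρ ≥ 0` there are `κ > 0` and
`D` such that for EVERY frame `K` of `C²` size `A` with `4A ≤ κ`, every `μ ∈ [μ₁, μ₂]`, every scale `n` and every target `q ∈ ℝ²`: the number of
sharp sectors `ι < sectorCount n` (width `w_n = π/2ⁿ`) containing the polar angle of a momentum `k ∈ [-π, π]²` of the thin frame shell
`|frameLevel μ K (k)| ≤ c_T w_n²` with `|k_i − q_i| ≤ c_ρ w_n` (`i = 0, 1`) is at most `D`.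
[cite: BenfattoGiulianiMastropietro2006, §2.8 (2.89), App. A3] -/
theorem lastLegCount_thin_frame :
    ∀ μ₁ μ₂ cT cρ : ℝ, -4 < μ₁ → μ₁ ≤ μ₂ → μ₂ < 0 → 0 ≤ cT → 0 ≤ cρ → ∃ κ : ℝ, 0 < κ ∧ ∃ D : ℝ, 0 < D ∧
      ∀ (K : TrigPolyC4v) (A : ℝ), (∀ p : Momentum, ∀ j ≤ 2, ‖iteratedFDeriv ℝ j (frameShift K) p‖ ≤ A) → 4 * A ≤ κ →
      ∀ μ ∈ Set.Icc μ₁ μ₂, ∀ (n : ℕ) (q : Fin 2 → ℝ),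
      ((((Finset.univ : Finset (Fin (sectorCount n))).filter (fun ι : Fin (sectorCount n) =>
        ∃ k : Fin 2 → ℝ, (∀ i, |k i| ≤ Real.pi) ∧ |frameLevel μ K (WithLp.toLp 2 k)| ≤ cT * sectorWidth n ^ 2 ∧
          sectorIndex n (Complex.arg (⟨k 0, k 1⟩ : ℂ)) = (ι : ℕ) ∧ (∀ i, |k i - q i| ≤ cρ * sectorWidth n))).card : ℕ) : ℝ) ≤ D := by
  intro μ₁ μ₂ cT cρ hμ₁ h12 hμ₂ hcT hcρ
  have ha : -4 < (μ₁ - 4) / 2 := by linarith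
  have hab : (μ₁ - 4) / 2 ≤ μ₂ / 2 := by linarith
  have hb : μ₂ / 2 < 0 := by linarith
  obtain ⟨B, -⟩ : ∃ B : BandBounds ((μ₁ - 4) / 2) (μ₂ / 2), B = bandBounds ha hab hb := ⟨_, rfl⟩
  obtain ⟨m₀, hm₀def⟩ : ∃ m₀ : ℝ, m₀ = min (μ₁ - (μ₁ - 4) / 2) (μ₂ / 2 - μ₂) := ⟨_, rfl⟩
  have hm₀ : 0 < m₀ := by rw [hm₀def]; exact lt_min (by linarith) (by linarith)
  have hm1 : m₀ ≤ μ₁ - (μ₁ - 4) / 2 := by rw [hm₀def]; exact min_le_left _ _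
  have hm2 : m₀ ≤ μ₂ / 2 - μ₂ := by rw [hm₀def]; exact min_le_right _ _
  have hDt := B.Dtmin_pos; have hum := B.umin_pos; have hs := B.smax_pos; have hπ := Real.pi_pos
  -- the perturbation size, the threshold on `w`, the constants
  obtain ⟨κ, hκdef⟩ : ∃ κ : ℝ, κ = min (B.Dtmin / 2) (m₀ / 2) := ⟨_, rfl⟩
  have hκ0 : 0 < κ := by rw [hκdef]; exact lt_min (by positivity) (by positivity)
  have hκD : κ ≤ B.Dtmin / 2 := by rw [hκdef]; exact min_le_left _ _
  have hκm : κ ≤ m₀ / 2 := by rw [hκdef]; exact min_le_right _ _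
  obtain ⟨w₀, hw₀⟩ : ∃ w₀ : ℝ, w₀ = min 1 (m₀ / (4 * (cT + 1))) := ⟨_, rfl⟩
  have hw₀pos : 0 < w₀ := by rw [hw₀]; exact lt_min one_pos (by positivity)
  obtain ⟨Cw, hCw⟩ : ∃ Cw : ℝ, Cw = cρ + 2 * (cT + B.smax * B.Dtmin / 2) / B.Dtmin := ⟨_, rfl⟩
  have hCw0 : 0 ≤ Cw := by rw [hCw]; positivity
  obtain ⟨D₁, hD₁⟩ : ∃ D₁ : ℝ, D₁ = 3 * (2 * (π * (Real.sqrt 2 * Cw / B.umin)) + 1) := ⟨_, rfl⟩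
  have hD₁pos : 0 < D₁ := by rw [hD₁]; positivity
  refine ⟨κ, hκ0, D₁ + 2 * π / w₀, by positivity, ?_⟩
  intro K A hA hAκ μ hμ n q
  have hA0 : 0 ≤ A := le_trans (norm_nonneg _) (hA 0 0 (by norm_num))
  have hA2 : 2 * A < B.Dtmin := by linarith
  have hAm : A ≤ m₀ / 8 := by linarith
  have hwpos : 0 < sectorWidth n := sectorWidth_pos n
  have hNw : (sectorCount n : ℝ) * sectorWidth n = 2 * π := sectorCount_mul_sectorWidth n
  have hsc : ∀ i : ℕ, sectorCenter n i = sectorWidth n / 2 + i * sectorWidth n := BandSectorCounting.sectorCenter_eq n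
  have hcen : ∀ φ : ℝ, ∃ m : ℤ, |φ + m * (2 * π) - sectorCenter n (sectorIndex n φ)| ≤ sectorWidth n / 2 :=
    exists_abs_arg_sub_sectorCenter_le n
  generalize hwdef : sectorWidth n = w at hwpos hNw hsc hcen ⊢
  -- the set to be counted, made opaque
  obtain ⟨S, hS⟩ : ∃ S : Finset (Fin (sectorCount n)), S = (Finset.univ : Finset (Fin (sectorCount n))).filter
      (fun ι : Fin (sectorCount n) => ∃ k : Fin 2 → ℝ, (∀ i, |k i| ≤ Real.pi) ∧ |frameLevel μ K (WithLp.toLp 2 k)| ≤ cT * w ^ 2 ∧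
        sectorIndex n (Complex.arg (⟨k 0, k 1⟩ : ℂ)) = (ι : ℕ) ∧ (∀ i, |k i - q i| ≤ cρ * w)) := ⟨_, rfl⟩
  rw [← hS]
  -- the trivial bound `#S ≤ N = 2π/w`
  have htriv : ((S.card : ℕ) : ℝ) ≤ 2 * π / w := by
    have h1 : S.card ≤ (Finset.univ : Finset (Fin (sectorCount n))).card := by rw [hS]; exact Finset.card_filter_le _ _
    rw [Finset.card_univ, Fintype.card_fin] at h1
    rw [le_div_iff₀ hwpos, ← hNw]
    exact mul_le_mul_of_nonneg_right (by exact_mod_cast h1) hwpos.le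
  by_cases hwle : w ≤ w₀
  · -- the main case: the shell fits in the level range
    have hw1 : w ≤ 1 := hwle.trans (by rw [hw₀]; exact min_le_left _ _)
    have hwm : w ≤ m₀ / (4 * (cT + 1)) := hwle.trans (by rw [hw₀]; exact min_le_right _ _)
    have hww : w ^ 2 ≤ w := by
      calc w ^ 2 = w * w := sq w
        _ ≤ 1 * w := mul_le_mul_of_nonneg_right hw1 hwpos.le
        _ = w := one_mul w
    have hTw : cT * w ^ 2 ≤ cT * w := mul_le_mul_of_nonneg_left hww hcT
    have hTm : cT * w ≤ m₀ / 4 := by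
      have h1 : cT * w ≤ cT * (m₀ / (4 * (cT + 1))) := mul_le_mul_of_nonneg_left hwm hcT
      have h2 : cT * (m₀ / (4 * (cT + 1))) ≤ m₀ / 4 := by
        rw [mul_div_assoc', div_le_div_iff₀ (by positivity) (by positivity)]
        have : 0 ≤ m₀ * 4 := by positivity
        nlinarith [this]
      exact h1.trans h2
    have hlo : (μ₁ - 4) / 2 ≤ μ - A - cT * w ^ 2 := by linarith [hμ.1]
    have hhi : μ + A + cT * w ^ 2 ≤ μ₂ / 2 := by linarith [hμ.2]
    have hlo' : (μ₁ - 4) / 2 ≤ μ - A := by linarith [hμ.1]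
    have hhi' : μ + A ≤ μ₂ / 2 := by linarith [hμ.2]
    -- root selection of the frame's curve and its radius lower bound
    have hδsq : ∀ k : Fin 2 → ℝ, (∀ i, |k i| ≤ π) → |(fun k : Fin 2 → ℝ => frameShift K (WithLp.toLp 2 k)) k| ≤ A :=
      fun k _ => abs_frameShift_toLp_le hA k
    obtain ⟨u, hudef⟩ : ∃ u : ℝ → ℝ, u = perturbedFermiRadius (fun k : Fin 2 → ℝ => frameShift K (WithLp.toLp 2 k)) μ := ⟨_, rfl⟩
    have hu : ∀ θ, IsBandFermiRadius (μ - (fun k : Fin 2 → ℝ => frameShift K (WithLp.toLp 2 k)) (u θ • dir θ)) θ (u θ) := by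
      rw [hudef]; exact fun θ => isBandFermiRadius_perturbedFermiRadius_frame B hA hlo' hhi' θ
    have humin : ∀ θ, B.umin ≤ u θ := fun θ => umin_le_of_shifted B hδsq hlo' hhi' (hu θ)
    have hFP : ∀ θ i, klFermiPoint μ K θ i = u θ * dir θ i := fun θ i => by
      rw [klFermiPoint_eq, hudef]; rfl
    -- the cell radius and the total radius `≤ Cw·w`
    obtain ⟨r, hr⟩ : ∃ r : ℝ, r = (cT * w ^ 2 + B.smax * B.Dtmin * (w / 2)) / (B.Dtmin - 2 * A) := ⟨_, rfl⟩
    have hden : B.Dtmin / 2 ≤ B.Dtmin - 2 * A := by linarith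
    have hden0 : 0 < B.Dtmin - 2 * A := by linarith
    have hr0 : 0 ≤ r := by rw [hr]; positivity
    have hρr : cρ * w + r ≤ Cw * w := by
      have hnum : cT * w ^ 2 + B.smax * B.Dtmin * (w / 2) ≤ cT * w + B.smax * B.Dtmin * (w / 2) := by linarith
      have hnum0 : 0 ≤ cT * w + B.smax * B.Dtmin * (w / 2) := by positivity
      have h1 : r ≤ (cT * w + B.smax * B.Dtmin * (w / 2)) / (B.Dtmin / 2) := by
        rw [hr]
        exact div_le_div₀ hnum0 hnum (by positivity) hden
      have e : (cT * w + B.smax * B.Dtmin * (w / 2)) / (B.Dtmin / 2) = 2 * (cT + B.smax * B.Dtmin / 2) / B.Dtmin * w := by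
        rw [div_eq_iff (by positivity)]
        field_simp
      rw [hCw, add_mul]
      linarith [h1, e]
    -- the radial grid box around the target, made opaque
    obtain ⟨T, hT⟩ : ∃ T : Finset ℕ, T = (Finset.range (sectorCount n)).filter fun ω : ℕ =>
        |u (w / 2 + ω * w) * Real.cos (w / 2 + ω * w) - q 0| ≤ Cw * w ∧
          |u (w / 2 + ω * w) * Real.sin (w / 2 + ω * w) - q 1| ≤ Cw * w := ⟨_, rfl⟩
    have hgrid : ((T.card : ℕ) : ℝ) ≤ 3 * (2 * (π * (Real.sqrt 2 * (Cw * w) / B.umin)) / w + 1) := by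
      rw [hT]
      exact card_grid_in_box_le_radial (x := q 0) (y := q 1) hum humin hwpos hNw (by positivity : 0 ≤ Cw * w)
    -- inclusion `S ↪ T` along `ι ↦ ι`
    have hsub : Set.MapsTo (fun ι : Fin (sectorCount n) => (ι : ℕ)) ↑S ↑T := by
      intro ι hι
      rw [Finset.mem_coe, hS, Finset.mem_filter] at hι
      obtain ⟨k, hk, hshell, hidx, hq⟩ := hι.2
      rw [Finset.mem_coe, hT, Finset.mem_filter, Finset.mem_range]
      refine ⟨ι.isLt, ?_⟩
      obtain ⟨mz, hmz⟩ := hcen (Complex.arg (⟨k 0, k 1⟩ : ℂ))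
      rw [hidx, hsc] at hmz
      have hc0 := frame_cell B hA hA2 (μ := μ) hk hshell hlo hhi hmz 0
      have hc1 := frame_cell B hA hA2 (μ := μ) hk hshell hlo hhi hmz 1
      rw [← hr] at hc0 hc1
      rw [hFP, dir_zero] at hc0
      rw [hFP, dir_one] at hc1
      constructor
      · calc |u (w / 2 + (ι : ℕ) * w) * Real.cos (w / 2 + (ι : ℕ) * w) - q 0|
            = |(k 0 - q 0) - (k 0 - u (w / 2 + (ι : ℕ) * w) * Real.cos (w / 2 + (ι : ℕ) * w))| := by ring_nf
          _ ≤ |k 0 - q 0| + |k 0 - u (w / 2 + (ι : ℕ) * w) * Real.cos (w / 2 + (ι : ℕ) * w)| := abs_sub _ _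
          _ ≤ cρ * w + r := add_le_add (hq 0) hc0
          _ ≤ Cw * w := hρr
      · calc |u (w / 2 + (ι : ℕ) * w) * Real.sin (w / 2 + (ι : ℕ) * w) - q 1|
            = |(k 1 - q 1) - (k 1 - u (w / 2 + (ι : ℕ) * w) * Real.sin (w / 2 + (ι : ℕ) * w))| := by ring_nf
          _ ≤ |k 1 - q 1| + |k 1 - u (w / 2 + (ι : ℕ) * w) * Real.sin (w / 2 + (ι : ℕ) * w)| := abs_sub _ _
          _ ≤ cρ * w + r := add_le_add (hq 1) hc1
          _ ≤ Cw * w := hρr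
    have hinj : Set.InjOn (fun ι : Fin (sectorCount n) => (ι : ℕ)) ↑S := fun ι _ ι' _ h => Fin.ext h
    have hST : S.card ≤ T.card := Finset.card_le_card_of_injOn (fun ι : Fin (sectorCount n) => (ι : ℕ)) hsub hinj
    have hD₁eq : 3 * (2 * (π * (Real.sqrt 2 * (Cw * w) / B.umin)) / w + 1) = D₁ := by
      rw [hD₁]
      field_simp
    have hSTr : ((S.card : ℕ) : ℝ) ≤ ((T.card : ℕ) : ℝ) := by exact_mod_cast hST
    have hpos : 0 < 2 * π / w₀ := by positivity
    linarith [hSTr, hgrid, hD₁eq, hpos]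
  · -- the trivial case `w > w₀`
    have hlt : w₀ < w := lt_of_not_ge hwle
    calc ((S.card : ℕ) : ℝ) ≤ 2 * π / w := htriv
      _ ≤ 2 * π / w₀ := div_le_div_of_nonneg_left (by positivity) hw₀pos hlt.le
      _ ≤ D₁ + 2 * π / w₀ := by linarith

end Summit.HubbardSuperconductivity.HubbardSuperconductivity.Theorems.PerturbedFermiCurve

end
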